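import Mathlib.Analysis.Matrix.PosDef
import Mathlib.LinearAlgebra.Matrix.ToLinearEquiv
import Literature.Analysis.Matrix.PencilCountTransfer
import Literature.Analysis.ValidatedNumerics.InertiaSpectrumSlicing
import HarnessLib

/-!
# The symmetric-definite pencil: eigenvalue counts of `A − t·B` ARE counts of pencil eigenvalues
# (Sylvester's law of inertia for the congruence `A − t·B = Rᵀ (C − t·1) R`, `B = RᵀR`)

Golub–Van Loan, *Matrix Computations*, 4th ed. [GolubVanLoan2013], §8.7.1 (the symmetric-definite
generalized eigenproblem `Ax = λBx`, `A = Aᵀ`, `B = Bᵀ ≻ 0`): with the Cholesky factor `B = GGᵀ` the pencil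
is reduced to the symmetric matrix `C = G⁻¹AG⁻ᵀ`, whose eigenvalues are the pencil eigenvalues
`λ(A, B)` (§8.7.2, Algorithm 8.7.1; congruence invariance of `λ(A, B)` §8.7.1; simultaneous diagonalisation
of the definite pair Cor. 8.7.2); and Thm 8.1.17 (Sylvester's law of inertia, p. 448): `A − t·B =
G (C − t·1) Gᵀ` has the same inertia as `C − t·1`, so **the number of eigenvalues of the MATRIX `A − t·B`
above / below / at `0` equals the number of pencil eigenvalues above / below / at `t`** — the «pencil
reading» that spectrum slicing for pencils (§8.7.1 with §8.4.2) rests on and that the tree's count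
certificates (`EigenvalueCount.card_eigenvalues_gt_add_le_card_pos_of_residual` …, and the slack transfer
`PencilCount.pencil_counts_of_shifted_count`) deliberately left to the client.

Here, for real matrices indexed by a `Fintype ι`, with the reduction written as DATA — any `R` with
`det R` a unit, `B = RᵀR`, and a symmetric `C` with `A = RᵀCR` (so `C = R⁻ᵀAR⁻¹`; `R = Gᵀ` for Cholesky,
`R = diag(√b)·Uᵀ` from the spectral theorem of `B`) — and `μ := hC.eigenvalues` (Mathlib's spectrum of
`C`, with multiplicity):

* `sub_smul_eq_congruence_diagonal` — `A − t·B = (RᵀU)·diag(μ − t)·(RᵀU)ᵀ` (`U` = eigenvector matrix of `C`);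
* `det_sub_smul_eq`, `det_sub_smul_eq_zero_iff`, `exists_mulVec_eq_smul_mulVec_iff` — `det(A − t·B) =
  det(RᵀU)²·∏(μⱼ − t)`; hence `det(A − tB) = 0 ↔ ∃ j, μⱼ = t ↔ ∃ x ≠ 0, Ax = t·Bx`: **the `μⱼ` are exactly
  the pencil eigenvalues** (§8.7.2 Alg. 8.7.1: `λ(A,B) = λ(C)`);
* `ncard_eigenvalues_sub_smul_pos_eq` / `…_neg_eq` / `…_zero_eq` — **the pencil reading**:
  `#{i | 0 < λᵢ(A − tB)} = #{j | t < μⱼ}`, `#{i | λᵢ(A − tB) < 0} = #{j | μⱼ < t}`,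
  `#{i | λᵢ(A − tB) = 0} = #{j | μⱼ = t}` (all `Set.ncard`; `card_filter_pos_eigenvalues_sub_smul_eq` is the
  `Finset` form the certificate files use);
* `exists_transpose_mul_self_of_posDef`, `exists_reduction_of_posDef` — for `B ≻ 0` such `R`, `C` exist;
* `pencil_eigenvalue_counts_of_shifted_count` — composed with `PencilCount.pencil_counts_of_shifted_count`:
  a count certificate for `W = A − s·B` with slack `τ` and a floor `β·xᵀx ≤ xᵀBx` gives
  `#{j | s + τ/β < μⱼ} ≤ n − ν ≤ #{j | s − τ/β < μⱼ}`; `lt_eigenvalues₀_of_shifted_count` /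
  `eigenvalues₀_le_of_shifted_count` — the index-wise reading for Mathlib's descending enumeration
  `eigenvalues₀`: `s − τ/β < μ↓ⱼ` for `j + 1 ≤ n − ν` and `μ↓ⱼ ≤ s + τ/β` for `n − ν ≤ j` (ascending, 0-based:
  the `ν`-th pencil eigenvalue exceeds `s − τ/β`, the `(ν−1)`-st is at most `s + τ/β`).

Everything is proved from the tree's Sylvester count
`Literature.Analysis.ValidatedNumerics.ncard_eigenvalues_gt_eq_of_congruence_diagonal` (and its `lt` / `eq`
companions) and the real Schur decomposition `sub_smul_one_eq_eigenvectorUnitary_congruence`; no named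
facts, no definitions, no floating point.  NOT here: that two reductions `R`, `R'` give the same `μ`
as a multiset (they do: `C' = QCQᵀ` with `Q = R'R⁻¹` orthogonal; consumers only ever need the counts,
which this file shows are independent of the choice since they equal counts of `A − tB`); complex
Hermitian pencils (`-- TODO(general form)`).

## References
* [GolubVanLoan2013] G. H. Golub, C. F. Van Loan, *Matrix Computations*, 4th ed., Johns Hopkins 2013 —
  §8.7.1 (λ(A,B), congruence invariance), §8.7.2 Algorithm 8.7.1 (Cholesky reduction `C = G⁻¹AG⁻ᵀ`,
  `λ(A,B) = λ(C)`), Cor. 8.7.2 (simultaneous diagonalisation of a definite pair), Thm 8.1.17 (Sylvester,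
  p. 448), §8.4.2 (spectrum slicing, p. 466).
* [HornJohnson2013] R. A. Horn, C. R. Johnson, *Matrix Analysis*, 2nd ed., CUP 2013 — Thm 4.5.8
  (Sylvester's law of inertia), Thm 7.6.4 (simultaneous diagonalisation of a definite pair by congruence).
-/

noncomputable section

open scoped Matrix

namespace Literature.Analysis.Matrix

namespace PencilCount

open Finset _root_.Matrix Literature.Analysis.ValidatedNumerics

variable {ι : Type*} [Fintype ι] [DecidableEq ι]
variable {A B C R : Matrix ι ι ℝ}

/-! ### §1 The congruence `A − t·B = Rᵀ (C − t·1) R` and its diagonal form -/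

omit [DecidableEq ι] in
/-- A congruence `RᵀCR` of a real symmetric `C` is symmetric (private helper). [folklore] -/
private theorem isHermitian_transpose_mul_mul (R : Matrix ι ι ℝ) (hC : C.IsHermitian) :
    (Rᵀ * C * R).IsHermitian := by
  have h := isHermitian_conjTranspose_mul_mul R hC
  rwa [conjTranspose_eq_transpose_of_trivial] at h

/-- **The reduction of the symmetric-definite pencil (Golub–Van Loan §8.7.2 Alg. 8.7.1):** with `B = RᵀR` and
`A = RᵀCR`, every shifted matrix of the pencil is a congruence of the shifted reduced matrix,
`A − t·B = Rᵀ (C − t·1) R`. [cite: GolubVanLoan2013, §8.7.2 Alg. 8.7.1 (Cholesky reduction, λ(A,B) = λ(C)) + Cor. 8.7.2] -/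
theorem sub_smul_eq_transpose_mul_sub_smul_one_mul (hB : B = Rᵀ * R) (hAC : A = Rᵀ * C * R) (t : ℝ) :
    A - t • B = Rᵀ * (C - t • (1 : Matrix ι ι ℝ)) * R := by
  rw [hB, hAC, Matrix.mul_sub, Matrix.sub_mul, Matrix.mul_smul, Matrix.smul_mul, Matrix.mul_one]

/-- **Diagonal form of the shifted pencil (Cor. 8.7.2; §8.7.2 Alg. 8.7.1 with the real Schur decomposition Thm 8.1.1):**
`A − t·B = (RᵀU) · diag(μ₁ − t, …, μₙ − t) · (RᵀU)ᵀ`, where `C = U·diag(μ)·Uᵀ` is the spectral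
decomposition of the reduced matrix (`U = hC.eigenvectorUnitary`, `μ = hC.eigenvalues`).
[cite: GolubVanLoan2013, Cor. 8.7.2 (simultaneous diagonalisation) with Thm 8.1.1] -/
theorem sub_smul_eq_congruence_diagonal (hC : C.IsHermitian) (hB : B = Rᵀ * R) (hAC : A = Rᵀ * C * R)
    (t : ℝ) :
    A - t • B = (Rᵀ * (hC.eigenvectorUnitary : Matrix ι ι ℝ))
      * diagonal (fun j => hC.eigenvalues j - t) * (Rᵀ * (hC.eigenvectorUnitary : Matrix ι ι ℝ))ᵀ := by
  rw [sub_smul_eq_transpose_mul_sub_smul_one_mul hB hAC t,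
    sub_smul_one_eq_eigenvectorUnitary_congruence hC t, transpose_mul, transpose_transpose]
  simp only [Matrix.mul_assoc]

/-- `det (RᵀU)` is a unit for `det R` a unit and `U` the (real orthogonal) eigenvector matrix of `C`
(private helper). [folklore] -/
private theorem isUnit_det_transpose_mul_eigenvectorUnitary (hC : C.IsHermitian) (hR : IsUnit R.det) :
    IsUnit (Rᵀ * (hC.eigenvectorUnitary : Matrix ι ι ℝ)).det := by
  rw [det_mul, det_transpose]
  exact hR.mul (isUnit_det_of_right_inverse (eigenvectorUnitary_mul_transpose hC))

/-! ### §2 The `μⱼ` are the pencil eigenvalues -/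

/-- `det(A − t·B) = det(RᵀU)² · ∏ⱼ (μⱼ − t)`. [cite: GolubVanLoan2013, §8.7.2 Alg. 8.7.1 (Cholesky reduction, λ(A,B) = λ(C)) + Cor. 8.7.2] -/
theorem det_sub_smul_eq (hC : C.IsHermitian) (hB : B = Rᵀ * R) (hAC : A = Rᵀ * C * R) (t : ℝ) :
    (A - t • B).det = (Rᵀ * (hC.eigenvectorUnitary : Matrix ι ι ℝ)).det ^ 2
      * ∏ j, (hC.eigenvalues j - t) := by
  rw [sub_smul_eq_congruence_diagonal hC hB hAC t, det_mul, det_mul, det_transpose, det_diagonal]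
  ring

/-- **`det(A − t·B) = 0 ↔ t` is an eigenvalue of the reduced matrix `C`** (`det R` a unit): the
spectrum of `C` is the set of pencil eigenvalues, with multiplicity. [cite: GolubVanLoan2013, §8.7.2 Alg. 8.7.1 (Cholesky reduction, λ(A,B) = λ(C)) + Cor. 8.7.2] -/
theorem det_sub_smul_eq_zero_iff (hC : C.IsHermitian) (hR : IsUnit R.det) (hB : B = Rᵀ * R)
    (hAC : A = Rᵀ * C * R) (t : ℝ) :
    (A - t • B).det = 0 ↔ ∃ j, hC.eigenvalues j = t := by
  rw [det_sub_smul_eq hC hB hAC t, mul_eq_zero, Finset.prod_eq_zero_iff]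
  have hL := (isUnit_det_transpose_mul_eigenvectorUnitary hC hR).ne_zero
  constructor
  · rintro (h | ⟨j, -, hj⟩)
    · exact (hL ((pow_eq_zero_iff two_ne_zero).mp h)).elim
    · exact ⟨j, sub_eq_zero.mp hj⟩
  · rintro ⟨j, hj⟩
    exact Or.inr ⟨j, mem_univ j, sub_eq_zero.mpr hj⟩

/-- **Pencil eigenvectors:** `Ax = t·Bx` has a nonzero solution iff `t` is an eigenvalue of the reduced
matrix `C`. [cite: GolubVanLoan2013, §8.7.1 (the generalized eigenproblem `Ax = λBx`, λ(A,B)) + §8.7.2 Alg. 8.7.1] -/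
theorem exists_mulVec_eq_smul_mulVec_iff (hC : C.IsHermitian) (hR : IsUnit R.det) (hB : B = Rᵀ * R)
    (hAC : A = Rᵀ * C * R) (t : ℝ) :
    (∃ x : ι → ℝ, x ≠ 0 ∧ A *ᵥ x = t • (B *ᵥ x)) ↔ ∃ j, hC.eigenvalues j = t := by
  rw [← det_sub_smul_eq_zero_iff hC hR hB hAC t, ← Matrix.exists_mulVec_eq_zero_iff]
  constructor
  · rintro ⟨x, hx, h⟩
    exact ⟨x, hx, by rw [sub_mulVec, smul_mulVec, h, sub_self]⟩
  · rintro ⟨x, hx, h⟩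
    refine ⟨x, hx, ?_⟩
    rw [sub_mulVec, smul_mulVec, sub_eq_zero] at h
    exact h

/-! ### §3 The pencil reading of the three counts (Sylvester's law of inertia) -/

section Counts

variable {t : ℝ}

/-- **Pencil reading, upper count (Golub–Van Loan Thm 8.1.17 applied to `A − tB = Rᵀ(C − t·1)R`):** the
number of POSITIVE eigenvalues of the matrix `A − t·B` equals the number of pencil eigenvalues
(eigenvalues of the reduced matrix `C`) ABOVE `t`. [cite: GolubVanLoan2013, Thm 8.1.17 (Sylvester, p. 448) with §8.7.2 Alg. 8.7.1 (Cholesky reduction, λ(A,B) = λ(C)) + Cor. 8.7.2] -/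
theorem ncard_eigenvalues_sub_smul_pos_eq (hW : (A - t • B).IsHermitian) (hC : C.IsHermitian)
    (hR : IsUnit R.det) (hB : B = Rᵀ * R) (hAC : A = Rᵀ * C * R) :
    {i | 0 < hW.eigenvalues i}.ncard = {j | t < hC.eigenvalues j}.ncard := by
  have h := ncard_eigenvalues_gt_eq_of_congruence_diagonal hW 0
    (isUnit_det_transpose_mul_eigenvectorUnitary hC hR)
    (d := fun j => hC.eigenvalues j - t) (by rw [zero_smul, sub_zero]; exact sub_smul_eq_congruence_diagonal hC hB hAC t)
  rw [h]
  congr 1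
  ext j
  simp only [Set.mem_setOf_eq, sub_pos]

/-- **Pencil reading, lower count:** the number of NEGATIVE eigenvalues of `A − t·B` equals the number of
pencil eigenvalues BELOW `t`. [cite: GolubVanLoan2013, Thm 8.1.17 (Sylvester, p. 448) with §8.7.2 Alg. 8.7.1 (Cholesky reduction, λ(A,B) = λ(C)) + Cor. 8.7.2] -/
theorem ncard_eigenvalues_sub_smul_neg_eq (hW : (A - t • B).IsHermitian) (hC : C.IsHermitian)
    (hR : IsUnit R.det) (hB : B = Rᵀ * R) (hAC : A = Rᵀ * C * R) :
    {i | hW.eigenvalues i < 0}.ncard = {j | hC.eigenvalues j < t}.ncard := by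
  have h := ncard_eigenvalues_lt_eq_of_congruence_diagonal hW 0
    (isUnit_det_transpose_mul_eigenvectorUnitary hC hR)
    (d := fun j => hC.eigenvalues j - t) (by rw [zero_smul, sub_zero]; exact sub_smul_eq_congruence_diagonal hC hB hAC t)
  rw [h]
  congr 1
  ext j
  simp only [Set.mem_setOf_eq, sub_neg]

/-- **Pencil reading, multiplicity:** the number of ZERO eigenvalues of `A − t·B` equals the
multiplicity of `t` as a pencil eigenvalue. [cite: GolubVanLoan2013, Thm 8.1.17 (Sylvester, p. 448) with §8.7.2 Alg. 8.7.1 (Cholesky reduction, λ(A,B) = λ(C)) + Cor. 8.7.2] -/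
theorem ncard_eigenvalues_sub_smul_zero_eq (hW : (A - t • B).IsHermitian) (hC : C.IsHermitian)
    (hR : IsUnit R.det) (hB : B = Rᵀ * R) (hAC : A = Rᵀ * C * R) :
    {i | hW.eigenvalues i = 0}.ncard = {j | hC.eigenvalues j = t}.ncard := by
  have h := ncard_eigenvalues_eq_eq_of_congruence_diagonal hW 0
    (isUnit_det_transpose_mul_eigenvectorUnitary hC hR)
    (d := fun j => hC.eigenvalues j - t) (by rw [zero_smul, sub_zero]; exact sub_smul_eq_congruence_diagonal hC hB hAC t)
  rw [h]
  congr 1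
  ext j
  simp only [Set.mem_setOf_eq, sub_eq_zero]

omit [DecidableEq ι] in
/-- `Set.ncard` of a decidable subset of a `Fintype` is the `Finset.filter` count. [folklore] -/
private theorem ncard_setOf_eq_card_filter (p : ι → Prop) [DecidablePred p] :
    {i | p i}.ncard = (univ.filter p).card := by
  classical
  rw [Set.ncard_eq_toFinset_card', Set.toFinset_setOf]

/-- The upper pencil count in the `Finset` form used by the certificate files:
`#{i | 0 < λᵢ(A − tB)} = #{j | t < μⱼ}`. [cite: GolubVanLoan2013, Thm 8.1.17 (Sylvester, p. 448) with §8.7.2 Alg. 8.7.1 (Cholesky reduction, λ(A,B) = λ(C)) + Cor. 8.7.2] -/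
theorem card_filter_pos_eigenvalues_sub_smul_eq (hW : (A - t • B).IsHermitian) (hC : C.IsHermitian)
    (hR : IsUnit R.det) (hB : B = Rᵀ * R) (hAC : A = Rᵀ * C * R) :
    (univ.filter fun i => 0 < hW.eigenvalues i).card = (univ.filter fun j => t < hC.eigenvalues j).card := by
  rw [← ncard_setOf_eq_card_filter (fun i => 0 < hW.eigenvalues i),
    ← ncard_setOf_eq_card_filter (fun j => t < hC.eigenvalues j)]
  exact ncard_eigenvalues_sub_smul_pos_eq hW hC hR hB hAC

/-- The lower pencil count, `Finset` form: `#{i | λᵢ(A − tB) < 0} = #{j | μⱼ < t}`.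
[cite: GolubVanLoan2013, Thm 8.1.17 (Sylvester, p. 448) with §8.7.2 Alg. 8.7.1 (Cholesky reduction, λ(A,B) = λ(C)) + Cor. 8.7.2] -/
theorem card_filter_neg_eigenvalues_sub_smul_eq (hW : (A - t • B).IsHermitian) (hC : C.IsHermitian)
    (hR : IsUnit R.det) (hB : B = Rᵀ * R) (hAC : A = Rᵀ * C * R) :
    (univ.filter fun i => hW.eigenvalues i < 0).card = (univ.filter fun j => hC.eigenvalues j < t).card := by
  rw [← ncard_setOf_eq_card_filter (fun i => hW.eigenvalues i < 0),
    ← ncard_setOf_eq_card_filter (fun j => hC.eigenvalues j < t)]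
  exact ncard_eigenvalues_sub_smul_neg_eq hW hC hR hB hAC

end Counts

/-! ### §4 Existence of the reduction for `B ≻ 0` -/

/-- **A positive definite real `B` is `RᵀR` with `R` nonsingular** (`R = diag(√b)·Uᵀ` from the spectral
decomposition `B = U·diag(b)·Uᵀ`, `b > 0`; the Cholesky factor `Gᵀ` of §8.7.1 is another such `R`).
[cite: GolubVanLoan2013, Thm 4.2.7 (Cholesky) / §8.7.2 Alg. 8.7.1 (the factor of the definite `B`)] -/
theorem exists_transpose_mul_self_of_posDef (hBpd : B.PosDef) :
    ∃ R : Matrix ι ι ℝ, IsUnit R.det ∧ B = Rᵀ * R := by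
  have hbpos : ∀ i, 0 < hBpd.1.eigenvalues i := fun i => hBpd.eigenvalues_pos i
  refine ⟨diagonal (fun i => Real.sqrt (hBpd.1.eigenvalues i))
    * (hBpd.1.eigenvectorUnitary : Matrix ι ι ℝ)ᵀ, ?_, ?_⟩
  · rw [det_mul, det_transpose, det_diagonal]
    refine (IsUnit.mk0 _ (Finset.prod_ne_zero_iff.mpr fun i _ => ?_)).mul
      (isUnit_det_of_right_inverse (eigenvectorUnitary_mul_transpose hBpd.1))
    exact (Real.sqrt_pos.mpr (hbpos i)).ne'
  · have hsp := sub_smul_one_eq_eigenvectorUnitary_congruence hBpd.1 0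
    rw [zero_smul, sub_zero] at hsp
    have hd : (fun i => Real.sqrt (hBpd.1.eigenvalues i) * Real.sqrt (hBpd.1.eigenvalues i))
        = fun i => hBpd.1.eigenvalues i - 0 :=
      funext fun i => by rw [sub_zero, Real.mul_self_sqrt (hbpos i).le]
    rw [transpose_mul, transpose_transpose, diagonal_transpose, Matrix.mul_assoc,
      ← Matrix.mul_assoc (diagonal _) (diagonal _), diagonal_mul_diagonal, hd, ← Matrix.mul_assoc]
    exact hsp

/-- **Reduction of a symmetric-definite pencil:** for `A` symmetric and `B ≻ 0` there are `R` nonsingular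
and `C` symmetric with `B = RᵀR`, `A = RᵀCR` (namely `C = R⁻ᵀAR⁻¹`); the eigenvalues of `C` are the pencil
eigenvalues `λ(A, B)`. [cite: GolubVanLoan2013, §8.7.2 Alg. 8.7.1 (Cholesky reduction, λ(A,B) = λ(C)) + Cor. 8.7.2] -/
theorem exists_reduction_of_posDef (hA : A.IsHermitian) (hBpd : B.PosDef) :
    ∃ R C : Matrix ι ι ℝ, IsUnit R.det ∧ B = Rᵀ * R ∧ C.IsHermitian ∧ A = Rᵀ * C * R := by
  obtain ⟨R, hR, hB⟩ := exists_transpose_mul_self_of_posDef hBpd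
  refine ⟨R, R⁻¹ᵀ * A * R⁻¹, hR, hB, isHermitian_transpose_mul_mul R⁻¹ hA, ?_⟩
  have h1 : Rᵀ * R⁻¹ᵀ = 1 := by rw [← transpose_mul, nonsing_inv_mul R hR, transpose_one]
  calc A = (Rᵀ * R⁻¹ᵀ) * A * (R⁻¹ * R) := by rw [h1, nonsing_inv_mul R hR, Matrix.one_mul, Matrix.mul_one]
    _ = Rᵀ * (R⁻¹ᵀ * A * R⁻¹) * R := by simp only [Matrix.mul_assoc]

/-! ### §5 Certificate counts ⇒ pencil eigenvalue counts and index-wise bounds -/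

section Certificate

variable {s τ β : ℝ}

/-- **Pencil eigenvalue counts from one shifted-matrix count certificate.** `A`, `B` real symmetric,
`β·xᵀx ≤ xᵀBx` (`β > 0`), `τ ≥ 0`, a count certificate for `W = A − s·B` with `#{i | τ < λᵢ(W)} ≤ m` and
`m ≤ #{i | −τ < λᵢ(W)}` (`m = n − ν` for an `LDLᵀ` with `ν` negative pivots), and a reduction `B = RᵀR`,
`A = RᵀCR` (`det R` a unit, `C` symmetric, `μ = λ(C)` the pencil eigenvalues): then
`#{j | s + τ/β < μⱼ} ≤ m ≤ #{j | s − τ/β < μⱼ}` — at most `m` pencil eigenvalues exceed `s + τ/β` and at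
least `m` exceed `s − τ/β`. [cite: GolubVanLoan2013, §8.7.1–§8.7.2 (Alg. 8.7.1) with §8.4.2 and Thm 8.1.17 (p. 448)] -/
theorem pencil_eigenvalue_counts_of_shifted_count (hA : A.IsHermitian) (hBh : B.IsHermitian) (hβ : 0 < β)
    (hBβ : ∀ x : ι → ℝ, β * (x ⬝ᵥ x) ≤ x ⬝ᵥ B *ᵥ x) (hτ : 0 ≤ τ) (s : ℝ) {m : ℕ}
    (hW : (A - s • B).IsHermitian)
    (hup : (univ.filter fun i => τ < hW.eigenvalues i).card ≤ m)
    (hlow : m ≤ (univ.filter fun i => -τ < hW.eigenvalues i).card)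
    (hC : C.IsHermitian) (hR : IsUnit R.det) (hB : B = Rᵀ * R) (hAC : A = Rᵀ * C * R) :
    (univ.filter fun j => s + τ / β < hC.eigenvalues j).card ≤ m ∧
      m ≤ (univ.filter fun j => s - τ / β < hC.eigenvalues j).card := by
  obtain ⟨h1, h2⟩ := pencil_counts_of_shifted_count hA hBh hβ hBβ hτ s hup hlow
  rw [card_filter_pos_eigenvalues_sub_smul_eq _ hC hR hB hAC] at h1
  rw [card_filter_pos_eigenvalues_sub_smul_eq _ hC hR hB hAC] at h2
  exact ⟨h1, h2⟩

omit [DecidableEq ι] in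
/-- Counting over the matrix index `ι` or over the sorted index `Fin |ι|` gives the same number. [folklore] -/
private theorem card_filter_eigenvalues_eq_card_filter_eigenvalues₀ [DecidableEq ι] {W : Matrix ι ι ℝ}
    (hW : W.IsHermitian) (p : ℝ → Prop) [DecidablePred p] :
    (univ.filter fun i : ι => p (hW.eigenvalues i)).card =
      (univ.filter fun j : Fin (Fintype.card ι) => p (hW.eigenvalues₀ j)).card := by
  rw [← Fintype.card_subtype, ← Fintype.card_subtype]
  exact Fintype.card_congr (Equiv.subtypeEquiv
    (Fintype.equivOfCardEq (Fintype.card_fin _)).symm fun i => Iff.rfl)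

/-- **Index-wise pencil reading, lower side:** under the hypotheses of
`pencil_eigenvalue_counts_of_shifted_count`, every pencil eigenvalue of descending index `j` with
`j + 1 ≤ m` exceeds `s − τ/β` (ascending, 0-based, `m = n − ν`: the pencil eigenvalues of index `≥ ν` lie
above `s − τ/β`). [cite: GolubVanLoan2013, §8.7.1–§8.7.2 (Alg. 8.7.1) with §8.4.2 (8.4.3)] -/
theorem lt_eigenvalues₀_of_shifted_count (hA : A.IsHermitian) (hBh : B.IsHermitian) (hβ : 0 < β)
    (hBβ : ∀ x : ι → ℝ, β * (x ⬝ᵥ x) ≤ x ⬝ᵥ B *ᵥ x) (hτ : 0 ≤ τ) (s : ℝ) {m : ℕ}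
    (hW : (A - s • B).IsHermitian)
    (hup : (univ.filter fun i => τ < hW.eigenvalues i).card ≤ m)
    (hlow : m ≤ (univ.filter fun i => -τ < hW.eigenvalues i).card)
    (hC : C.IsHermitian) (hR : IsUnit R.det) (hB : B = Rᵀ * R) (hAC : A = Rᵀ * C * R)
    (j : Fin (Fintype.card ι)) (hj : (j : ℕ) + 1 ≤ m) :
    s - τ / β < hC.eigenvalues₀ j := by
  have h := (pencil_eigenvalue_counts_of_shifted_count hA hBh hβ hBβ hτ s hW hup hlow hC hR hB hAC).2
  rw [card_filter_eigenvalues_eq_card_filter_eigenvalues₀ hC (s - τ / β < ·)] at h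
  exact EigenvalueCount.lt_of_succ_le_card_filter hC.eigenvalues₀_antitone j (hj.trans h)

/-- **Index-wise pencil reading, upper side:** under the same hypotheses, every pencil eigenvalue of
descending index `j ≥ m` is at most `s + τ/β` (ascending, 0-based, `m = n − ν`: the pencil eigenvalues of
index `≤ ν − 1` lie at or below `s + τ/β`) — together: exactly `ν` pencil eigenvalues below the cut `s`, up
to the slack `τ/β`. [cite: GolubVanLoan2013, §8.7.1–§8.7.2 (Alg. 8.7.1) with §8.4.2 (8.4.3)] -/
theorem eigenvalues₀_le_of_shifted_count (hA : A.IsHermitian) (hBh : B.IsHermitian) (hβ : 0 < β)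
    (hBβ : ∀ x : ι → ℝ, β * (x ⬝ᵥ x) ≤ x ⬝ᵥ B *ᵥ x) (hτ : 0 ≤ τ) (s : ℝ) {m : ℕ}
    (hW : (A - s • B).IsHermitian)
    (hup : (univ.filter fun i => τ < hW.eigenvalues i).card ≤ m)
    (hlow : m ≤ (univ.filter fun i => -τ < hW.eigenvalues i).card)
    (hC : C.IsHermitian) (hR : IsUnit R.det) (hB : B = Rᵀ * R) (hAC : A = Rᵀ * C * R)
    (j : Fin (Fintype.card ι)) (hj : m ≤ (j : ℕ)) :
    hC.eigenvalues₀ j ≤ s + τ / β := by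
  have h := (pencil_eigenvalue_counts_of_shifted_count hA hBh hβ hBβ hτ s hW hup hlow hC hR hB hAC).1
  rw [card_filter_eigenvalues_eq_card_filter_eigenvalues₀ hC (s + τ / β < ·)] at h
  exact EigenvalueCount.le_of_card_filter_le hC.eigenvalues₀_antitone j (h.trans hj)

end Certificate

end PencilCount

end Literature.Analysis.Matrix
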